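import Summits.QuantumFields.BalabanUV.T4Continuum.Support.NE9Lemma1CurveSpecies
import Summits.QuantumFields.BalabanUV.T4Continuum.Support.NE9Lemma1KernelSpecies
import Summits.QuantumFields.BalabanUV.T4Continuum.Support.NE9Lemma1RemainderSpeciesEnd
import Summits.QuantumFields.BalabanUV.T4Continuum.Support.NE9ChannelSum

/-!
# NE9Lemma1SpeciesEnd — the NE9 frame's END (`…_compProj` face) at the ASSEMBLED species channel 𝒯 = 𝒯_(a) + 𝒯_(b) of
# [I] §§3–4: (a) the fifth-order remainder along Bałaban's slice curves (`NE9Lemma1CurveSpecies`), (b) the point-localized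
# terms of §4 (`NE9Lemma1KernelSpecies`) — S3-sum / S5 of the SUM discharged BY NAME from the two species' leaves and the
# crew's channel-sum assembly (`NE9ChannelSum`, (w25)); S3-additivity of each species displayed ((w19), (w23))
# (cell `pub-balaban`, T4-DAG §2 node U3 / §6 NE9; lineage t4-ne9-p1 = row NE9 OWNER, generation 25)

HONEST FRAMING (T4-DAG PAGE 1).  Rung (B)+1 of the FINITE-VOLUME T⁴ programme — NOT infinite volume, NOT a mass gap, NOT the
Clay problem.  NE9 (`T4OutputRate.NE9` ∧ `FadingMemory`) is a cell NEW ESTIMATE, NOT PRINTED, NOT discharged here; spine 0/9.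
HONEST DEPENDENCY (cell line, verbatim): continuum YM on T⁴ ⇐ BetaPertH ∧ nine spine estimates (0/9 proved); BetaPertH ⇐ (D1)
∧ (D4) ∧ CAP+tail; G-an2-4 gates asym, D1 and NE2/3/4.  `FlowStep.BetaPertH`, (B), (B^μ) do not occur.  [I] = [Balaban1987RG1]
(CMP **109**), [II] = [Balaban1988RG2Cluster] (CMP **116**) are quoted for TYPES only (ABSOLUTE RULE: nothing printed in the
audited series is asserted).

WHAT THIS FILE IS.  [I] (3.34) p. 277 splits the old term at the new background into the orders ≤ 4 and the fifth-order remainder;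
[II] (1.33) p. 9 sums the localized pieces of ALL of them (*"a sum over all admissible □₀, Y₀, j and X"*, p. 7).  Gen 25 landed
the S5 leaf for each family separately — `channelSizeAtStepNN_cur` (gain ℓ⁵ at the input rate κ, counts at κ) and
`channelSizeAtStepNN_ker` (gain `gain`, counts at the OUTPUT rate κ − w) — and the crew's `NE9ChannelSum` ((w25), leaf-07) the
assembly `channelSizeAtStepNN_add_cpiece` (common output frame: the same d_k(Y)).  THIS FILE feeds the skeleton's END on the
corrected dictionary (`NE9MarginalProjectionEnd.ne9_and_fadingMemory_of_couplingTwoPoint_vacSub_sizeInduction_compProj`) with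
`𝒯 := cpieceChannel D.toC + cpieceChannel K.toC`:
**`termSize_ne9_and_fadingMemory_species_compProj`** — `hsum` := `channelStepSum_add` of the two `channelStepSum_cpiece`,
`hstep` := `channelSizeAtStepNN_add_cpiece` of the two species' S5 leaves restricted to `MF` (weight `weightOf D.toC.frame κ₁ d₀ O1
(Kp_(a) + Kp_(b))`, profile `tauOfG cQ_(a) ℓ′ + tauOfG cQ_(b) ℓ′`, ℓ′ = agePow ω), `hτ` := the two `profileG`s added (τ̄ = cQ_(a) +
cQ_(b)), `hadd` := `channelAdditive_add` of the two DISPLAYED `PieceAdditiveOn` binders ((w19) p214120 for curves; (w23) for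
kernels); identification binders: the two species share κ₁, d₀, O1, the radii `R` and the output geometry `dY` (they are
Bałaban's κ₁, d_k(□₀)-floor, (1.28)-constant, 𝔘^c_j-radii and d_k(Y) — ONE set of objects read by two data).  Conclusion
LITERALLY the face's with `ω′ = ω + 8·lipbar·B·((1 + c)·(cQ_(a) + cQ_(b)))`.  So for the assembled species channel the displayed
list is: O1-type data (`CurData` curves, `KerData` bilocal summands, carriers, `P`, `Ψ`, `act`, `ρ`, …), `CurData.Admissible`
(Lemma 4 (3.53) TYPE + gain letter + G1), `KerData.Admissible` ((K) p. 286 TYPE, (G), (S), G1), the two level counts (at κ and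
at κ − w), the two additivity binders, `MF ⊆ analyticClass`, and the face's own A1/A2/A3/RO-type binders and scalars.
DISGUISE TEST: unchanged from the face (skeleton §5 (g2)).

References (TYPES only): [Balaban1987RG1] T. Bałaban, CMP **109** (1987) 249–301, (3.34) p. 277, Lemma 4 (3.53)–(3.54) p. 280,
(4.21)–(4.22) pp. 285–286; [Balaban1988RG2Cluster] T. Bałaban, CMP **116** (1988) 1–22, (1.23)–(1.29) pp. 7–8, (1.33)–(1.36)
p. 9.  Summits-side NEW work (LEAN PLACEMENT RULE); imports the two species modules, gen 24's `NE9Lemma1RemainderSpeciesEnd`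
(antitonicity lemmas + the face) and the crew's `NE9ChannelSum` BY NAME; modifies nothing; 0 sorry.  Value = bookkeeping: the
END displayed list for the FULL species channel of [I] §§3–4, NOT summit progress.
-/

noncomputable section

namespace Summit.QuantumFields.BalabanUV.T4Continuum.NE9Lemma1SpeciesEnd

open scoped BigOperators
open Literature.Probability.LatticeModels
open Literature.MathematicalPhysics.QuantumFieldTheory.Balaban1983to89
open Literature.MathematicalPhysics.QuantumFieldTheory.Balaban1983to89.T4OutputRate
open Literature.MathematicalPhysics.QuantumFieldTheory.Balaban1983to89.T4HistoryLipschitzRecursion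
open Literature.MathematicalPhysics.QuantumFieldTheory.Balaban1983to89.T4HistoryLipschitzOuter
open Literature.MathematicalPhysics.QuantumFieldTheory.Balaban1983to89.T4HistoryLipschitzActivity
open Literature.MathematicalPhysics.QuantumFieldTheory.Balaban1983to89.T4HistoryLipschitzActivity (ClusterGeom)
open Literature.MathematicalPhysics.QuantumFieldTheory.Balaban1983to89.T4HistoryLipschitzSegment
open Summit.QuantumFields.BalabanUV.T4Continuum.NE9Lemma1Counting
open Summit.QuantumFields.BalabanUV.T4Continuum.NE9Lemma1Gain
open Summit.QuantumFields.BalabanUV.T4Continuum.NE9Lemma1PieceClass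
open Summit.QuantumFields.BalabanUV.T4Continuum.NE9Lemma1RemainderSpecies
open Summit.QuantumFields.BalabanUV.T4Continuum.NE9Lemma1CurveSpecies
open Summit.QuantumFields.BalabanUV.T4Continuum.NE9Lemma1KernelSpecies
open Summit.QuantumFields.BalabanUV.T4Continuum.NE9Lemma1RemainderSpeciesEnd
open Summit.QuantumFields.BalabanUV.T4Continuum.NE9ChannelSum
open Summit.QuantumFields.BalabanUV.T4Continuum.NE9ComplexEncoding (doubleCarriers)
open Summit.QuantumFields.BalabanUV.T4Continuum.NE9MarginalProjection
open Summit.QuantumFields.BalabanUV.T4Continuum.NE9MarginalProjectionEnd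

variable {C₀ : Carriers} {E : Type} [NormedAddCommGroup E] [NormedSpace ℂ E]
  {ι α β γ δ α' β' γ' δ' Pt : Type} [DecidableEq δ] [DecidableEq δ']

/-- The summed profile of the two species is geometric with constant `cQ_(a) + cQ_(b)`. [folklore] -/
theorem profile_species {cQa cQb ω : ℝ} (hcQa : 0 ≤ cQa) (hcQb : 0 ≤ cQb) (hω : 0 ≤ ω) :
    ∀ k j, j ≤ k → 0 ≤ (tauOfG cQa (agePow ω) + tauOfG cQb (agePow ω)) k j ∧
      (tauOfG cQa (agePow ω) + tauOfG cQb (agePow ω)) k j ≤ (cQa + cQb) * ω ^ (k - j) := by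
  intro k j hjk
  have ha := (profileG hcQa hω (ω := ω)).1 k j hjk
  have hb := (profileG hcQb hω (ω := ω)).1 k j hjk
  have ha0 : 0 ≤ tauOfG cQa (agePow ω) k j := mul_nonneg hcQa (agePow_nonneg hω k j)
  have hb0 : 0 ≤ tauOfG cQb (agePow ω) k j := mul_nonneg hcQb (agePow_nonneg hω k j)
  simp only [Pi.add_apply]
  exact ⟨add_nonneg ha0 hb0, by linarith⟩

/-- **THE NE9 END (`…_compProj` face) AT THE ASSEMBLED SPECIES CHANNEL 𝒯 = 𝒯_(a) + 𝒯_(b)** (curves + point-localized terms).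
DISCHARGED BY NAME: `ChannelStepSum MF 𝒯` (`channelStepSum_add` ∘ `channelStepSum_cpiece` ×2), `ChannelSizeAtStepNN MF 𝒯 κ wt τ`
(`NE9ChannelSum.channelSizeAtStepNN_add_cpiece` ∘ `channelSizeAtStepNN_cur` ∘ `channelSizeAtStepNN_ker`, both restricted to
`MF`), the profile (`profile_species`), `ChannelAdditive MF 𝒯` from the two DISPLAYED `PieceAdditiveOn` binders
(`channelAdditive_add`).  Identification binders: the kernel datum reads the SAME κ₁, radii and output geometry as the curve
datum (`hκ₁`, `hR`, `hdY`); level counts of (a) at κ, of (b) at κ − w, common (1.28)-constant O1.  DISPLAYED otherwise as in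
gen 24's part 3.  Conclusion LITERALLY the face's with τ̄ = cQ_(a) + cQ_(b).
[cite: Balaban1987RG1, (3.34) p.277, (3.53)-(3.54) p.280, (4.22) p.286; Balaban1988RG2Cluster, (1.23)-(1.29) pp.7-8, (1.33)-(1.36) p.9] -/
theorem termSize_ne9_and_fadingMemory_species_compProj (G : ClusterGeom (doubleCarriers C₀)) {Pot : Type*}
    [NormedAddCommGroup Pot] [NormedSpace ℂ Pot] {D : CurData C₀ E ι α β γ δ} {K : KerData C₀ E ι α' β' γ' δ' Pt}
    {ℓg ℓk gain : ℕ → ℕ → ℝ} {cdir cK δ₀ δ₁ w w0 c0 c1 d0 O1 cQa cQb : ℝ}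
    {Ef : Functional (doubleCarriers C₀) E} {W : Set (ℕ → ℝ)}
    {Adm MF : Set (E → (doubleCarriers C₀).Dom → ℝ)}
    {P : (E → (doubleCarriers C₀).Dom → ℝ) → (E → (doubleCarriers C₀).Dom → ℝ)}
    {Ψ : ℕ → ℝ → (ι → ℝ) → E → (doubleCarriers C₀).Dom → ℝ} {act : ℕ → ℝ → E → Pot → G.P → ℂ} {𝒜 : ℕ → Set Pot}
    {n : ℕ → ℝ → E → G.P → ℝ} {lip clip : ℕ → ℝ} {a d : G.P → ℝ} {δv : (doubleCarriers C₀).Dom → ℝ}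
    {κ B lipbar clipbar qTbar ω c : ℝ} {qT p₀ N : ℕ → ℝ}
    -- species (a): the curve datum and its binders
    (hD : D.Admissible ℓg cdir d0) (hℓg : ∀ k j, 0 ≤ ℓg k j)
    (hLa : LevelCountsG D.toC.frame κ D.κ₁ O1 cQa (fun k j => ℓg k j ^ 5) (agePow ω))
    (hAa : PieceAdditiveOn (analyticClass D.R) D.toC)
    -- species (b): the kernel datum and its binders, on the SAME κ₁ / radii / output geometry
    (hK : K.Admissible ℓk gain cK δ₀ δ₁ w w0 c0 c1 d0) (hκ₁ : K.κ₁ = D.κ₁) (hR : K.R = D.R)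
    (hdY : K.toC.frame.dY = D.toC.frame.dY)
    (hLb : LevelCountsG K.toC.frame (κ - w) K.κ₁ O1 cQb gain (agePow ω))
    (hAb : PieceAdditiveOn (analyticClass K.R) K.toC)
    (hO1 : 0 ≤ O1) (hcQa : 0 ≤ cQa) (hcQb : 0 ≤ cQb) (hMF : MF ⊆ analyticClass D.R)
    -- the face's binders, verbatim, at 𝒯 := cpieceChannel D.toC + cpieceChannel K.toC
    (ρ : ℕ → (ι → ℝ) → Pot) (U₀ : E) (explZ : ℕ → E → (doubleCarriers C₀).Dom → ℝ) (h0 : ScaleZeroFree Ef W)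
    (hAdm : AdmissibleTerms Ef W Adm) (hres : AdmRestrict Adm)
    (hPadd : ProjAdditive Adm P) (hPcomm : ProjScaleComm Adm P) (hPinto : ProjInto Adm MF P) (hPsize : ProjSize Adm P κ c)
    (hc : 0 ≤ c)
    (hfac : Factorises Ef W (compProj (cpieceChannel D.toC + cpieceChannel K.toC) P) Ψ) (hclip0 : ∀ k, 0 ≤ clip k)
    (hCup : ∀ g ∈ W, ∀ g' ∈ W, ∀ (k : ℕ) (U : E) (X : (doubleCarriers C₀).Dom), (doubleCarriers C₀).scale X = k + 1 →
      ∀ Q ∈ 𝒜 k, ∀ γ' ∈ G.vol X,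
      ‖act k (g k) U Q γ'‖ ≤ n k (g' k) U γ' ∧
        ‖act k (g k) U Q γ' - act k (g' k) U Q γ'‖ ≤ clip k * |g k - g' k| * n k (g' k) U γ')
    (hqT0 : ∀ k, 0 ≤ qT k)
    (hTcup : ∀ g ∈ W, ∀ g' ∈ W, ∀ (k : ℕ) (y : ι),
      |compProj (cpieceChannel D.toC + cpieceChannel K.toC) P k g (Ef g) y -
        compProj (cpieceChannel D.toC + cpieceChannel K.toC) P k g' (Ef g) y| ≤
        weightOf D.toC.frame D.κ₁ d0 O1 (D.Kp cdir + K.Kp cK w0 c0 c1) k y * (qT k * |g k - g' k|))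
    (hreprV : ∀ (k : ℕ) (s : ℝ) (Q : ι → ℝ) (U : E) (X : (doubleCarriers C₀).Dom),
      Ψ k s Q U X = (G.newTerm act k s U X (ρ k Q)).re - (G.newTerm act k s U₀ X (ρ k Q)).re + explZ k U X)
    (hclipb : ∀ k, clip k ≤ clipbar) (hqTb : ∀ k, qT k ≤ qTbar)
    (hKP : TwoPointKP G W act 𝒜 n lip a d) (hdec : G.DecayExtract δv d) (hpin : G.PinBudget a δv (fun _ => B) κ)
    (hρ : ∀ (k : ℕ) (Q Q' : ι → ℝ) (M : ℝ),
      (∀ y, |Q y - Q' y| ≤ weightOf D.toC.frame D.κ₁ d0 O1 (D.Kp cdir + K.Kp cK w0 c0 c1) k y * M) →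
        ‖ρ k Q - ρ k Q'‖ ≤ M)
    (hexplZ : ∀ (k : ℕ) (U : E) (X : (doubleCarriers C₀).Dom), (doubleCarriers C₀).scale X = k + 1 →
      |explZ k U X| ≤ Real.exp (-(κ * (doubleCarriers C₀).d X)) * p₀ k)
    (hbase : ∀ g ∈ W, ∀ (U : E) (X : (doubleCarriers C₀).Dom), (doubleCarriers C₀).scale X = 0 →
      |Ef g U X| ≤ Real.exp (-(κ * (doubleCarriers C₀).d X)) * N 0)
    (hNsucc : ∀ j, p₀ j + 2 * B ≤ N (j + 1)) (hNnn : ∀ j, 0 ≤ N j)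
    (hbox : ∀ (k : ℕ) (Q : ι → ℝ), (∀ y, |Q y| ≤ weightOf D.toC.frame D.κ₁ d0 O1 (D.Kp cdir + K.Kp cK w0 c0 c1) k y *
      sizeRadius (fun k j => (1 + c) * (tauOfG cQa (agePow ω) + tauOfG cQb (agePow ω)) k j) N k) → ρ k Q ∈ 𝒜 k)
    (hB : 0 ≤ B) (hlipb : ∀ k, lip k ≤ lipbar) (hω : 0 ≤ ω)
    (hpos : 0 < ω + 8 * lipbar * B * ((1 + c) * (cQa + cQb))) :
    TermSize Ef W κ N ∧
      NE9 Ef W κ (prodModuli (8 * clipbar * B + 8 * lipbar * B * qTbar)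
        fun _ => ω + 8 * lipbar * B * ((1 + c) * (cQa + cQb))) ∧
        FadingMemory ((8 * clipbar * B + 8 * lipbar * B * qTbar) / (ω + 8 * lipbar * B * ((1 + c) * (cQa + cQb))))
          (ω + 8 * lipbar * B * ((1 + c) * (cQa + cQb)))
          (prodModuli (8 * clipbar * B + 8 * lipbar * B * qTbar)
            fun _ => ω + 8 * lipbar * B * ((1 + c) * (cQa + cQb))) := by
  -- the kernel species' class is the curve species' class (same radii)
  have hMFb : MF ⊆ analyticClass K.R := by rw [hR]; exact hMF
  -- S-SUM of the sum
  have hsum : ChannelStepSum MF (cpieceChannel D.toC + cpieceChannel K.toC) :=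
    channelStepSum_add (channelStepSum_cpiece (pieceZero_cur D) (pieceLocal_cur D) (csrcScale_cur hD) MF)
      (channelStepSum_cpiece (pieceZero_ker hK.kerZero) (pieceLocal_ker K) (csrcScale_ker hK) MF)
  -- S5 of each species on MF
  have ha : ChannelSizeAtStepNN MF (cpieceChannel D.toC) κ (weightOf D.toC.frame D.κ₁ d0 O1 (D.Kp cdir))
      (tauOfG cQa (agePow ω)) :=
    channelSizeAtStepNN_mono hMF
      (channelSizeAtStepNN_cur hD hℓg κ hLa hO1 (fun k j => mul_nonneg hcQa (agePow_nonneg hω k j)))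
  have hb : ChannelSizeAtStepNN MF (cpieceChannel K.toC) κ (weightOf K.toC.frame D.κ₁ d0 O1 (K.Kp cK w0 c0 c1))
      (tauOfG cQb (agePow ω)) := by
    have h := channelSizeAtStepNN_mono hMFb
      (channelSizeAtStepNN_ker hK κ hLb hO1 (fun k j => mul_nonneg hcQb (agePow_nonneg hω k j)))
    rw [hκ₁] at h
    exact h
  -- S5 of the sum (crew (w25), common output frame)
  have hstep : ChannelSizeAtStepNN MF (cpieceChannel D.toC + cpieceChannel K.toC) κ
      (weightOf D.toC.frame D.κ₁ d0 O1 (D.Kp cdir + K.Kp cK w0 c0 c1))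
      (tauOfG cQa (agePow ω) + tauOfG cQb (agePow ω)) :=
    channelSizeAtStepNN_add_cpiece D.toC K.toC hdY ha hb (kp_nonneg hD) (kp_nonneg_ker hK) hO1
      (fun k j _ => mul_nonneg hcQa (agePow_nonneg hω k j)) (fun k j _ => mul_nonneg hcQb (agePow_nonneg hω k j))
  -- S3 of the sum from the displayed piece-additivity of each species
  have hadd : ChannelAdditive MF (cpieceChannel D.toC + cpieceChannel K.toC) :=
    channelAdditive_add (channelAdditive_cpiece (pieceAdditiveOn_mono hMF hAa))
      (channelAdditive_cpiece (pieceAdditiveOn_mono hMFb hAb))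
  have hτ := profile_species hcQa hcQb hω
  exact ne9_and_fadingMemory_of_couplingTwoPoint_vacSub_sizeInduction_compProj G ρ U₀ explZ h0 hAdm hres hPadd hPcomm
    hPinto hPsize hc hadd hsum hstep hfac hclip0 hCup hqT0 hTcup hreprV hclipb hqTb hKP hdec hpin hρ hexplZ hbase hNsucc hNnn
    hbox hB hlipb (add_nonneg hcQa hcQb) hω hpos hτ

end Summit.QuantumFields.BalabanUV.T4Continuum.NE9Lemma1SpeciesEnd
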